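import Summits.CriticalPhenomena.PercolationContinuityZ3.Theorems.FK.InfiniteVolumeOneEdgeDLRClosed
import Literature.Probability.Percolation.LocalEvents
import Literature.Probability.Percolation.LocalLimitConnections
import HarnessLib

/-!
# FK-continuity transplant, FO-10 (infinite-volume structure): local limits of random-cluster measures —
# exits, finite energy of the limit, and the null bad events (Grimmett 2006, Lemma (4.39), Thm. (4.33)(b), proof of Thm. (4.31))

Registered R90 (cell INBOX l.6412, 2026-08-24); registry row FO-10b-g409; label DLL-A (coordinator fk-4 g195).
Cell `fk-continuity` (bschramm), FO-10b lineage; support file for the FK-continuity transplant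
(`--supports stmt-CriticalPhenomena-4575`); builds on p205010 (kernel theorem, internal audit signed; external
expert review pending). CONDITIONAL cell (FH AND TP_FK open at the same `p` for `q > 1`; K1); the transplant is a
typed reduction, not a proof of FK continuity — this file is UNCONDITIONAL infinite-volume structure for general `d`;
no defs, no named facts, no sorries, standard axioms; NOT a binder discharge, NOT `_r4`; `_r3` « 2 / 0 ☑ »
unchanged, n_open = 2.

## Setting (Grimmett 2006, §4.4, proof of Thm. (4.31), pp. 83–86) and what this file proves

A sequence of finite measures `μ_n` on `Ω = {0,1}^{pairs of ℤ^d}` converges to `P` ON LOCAL EVENTS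
(`∀ A, IsLocalEvent A → μ_n(A) → P(A)` — the tree's local-limit convention of
`Literature.Probability.Percolation.LocalLimitConnections`), and EVENTUALLY has the one-edge conditional
probabilities (4.38) at the lattice edge `e = ⟨x,y⟩` (the hypothesis shape `hE` of `isDLRRandomCluster_of_oneEdge`,
`InfiniteVolumeDLROneEdgeIff.lean`). This first file of the pair (sequel: `InfiniteVolumeDLRLocalLimit.lean`) holds
the inputs of Grimmett's proof of Thm. (4.31) that do not involve the limit identity itself:

* `exists_exit_of_reachable_of_not_mem_openConnVia`, `mem_exit_inter_of_mem_openConn_diff` — the combinatorial step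
  of Lemma (4.39) ON THE INFINITE LATTICE: for a lattice configuration, `{x ↔ y} ∖ {x ↔ y inside Λ_m} ⊆ D_m :=
  {x exits Λ_m} ∩ {y exits Λ_m} ∩ {x ↮ y inside Λ_m}` (a LOCAL event);
* `measureReal_setOf_mem_inter_preimage_le_of_oneEdge`, `…_le_of_localLimit_of_isLocalEvent`,
  `…_le_of_forall_isLocalEvent` — ONE-SIDED FINITE ENERGY OF THE LOCAL LIMIT (Thm. (4.33)(b)):
  `P({e open} ∩ {ω ∖ e ∈ H₀}) ≤ max(p, p/(p+q(1-p))) · P({ω ∖ e ∈ H₀})` for every measurable `H₀`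
  (local `H₀` by passing to the limit, then all `H₀` by approximation in `P ∘ (· ∖ e)⁻¹`-measure);
* `measureReal_preimage_sdiff_not_numInfiniteClusters_le_one_eq_zero` — Grimmett's (4.42): if `P`-a.s. there is at
  most one infinite cluster and the energy constant is `< 1`, then `P`-a.s. `ω ∖ e` has at most one infinite cluster;
* `tendsto_measureReal_exit_inter_not_openConnVia` — hence `P(D_m) → 0` (last display of the proof of Thm. (4.31),
  p. 86: `D_m ⊆ ⋃_{k ≥ m} D_k ↓ {ω ∖ e has two infinite clusters}`), for ANY finite measure with that null event
  (the box-limit special case is FO-06b's `IsBoxLimit.tendsto_real_exit_inter_not_openConnVia`).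
* `measureReal_setOf_mem_inter_preimage_eq_of_forall_isLocalEvent` — the one-edge identity (4.38) extends from LOCAL to
  all measurable `H₀` (two finite measures agreeing on local events agree, `Literature…LocalEvents.ext_of_isLocalEvent`,
  applied to `A ↦ P({e open} ∩ {ω ∖ e ∈ A})` and `A ↦ p P({ω ∖ e ∈ A ∩ K_e}) + π P({ω ∖ e ∈ A ∖ K_e})`);
* bookkeeping: `tendsto_measureReal_of_tendsto_measure_isLocalEvent` (local convergence read on `ℝ`),
  `measureReal_preimage_sdiff_eq_add` (splitting `{ω ∖ e ∈ H₀}` along `K_e`).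

## References

* G. Grimmett, *The Random-Cluster Model*, Springer 2006: Thm. (4.17)(b), Def. (4.29)–(4.30), Thm. (4.31), (4.32),
  Thm. (4.33)(b), Prop. (4.37) eq. (4.38), Lemma (4.39) eqs. (4.40)–(4.42), proof of Thm. (4.31) pp. 83–86. [Grimmett2006]
-/

noncomputable section

open MeasureTheory Set Filter
open scoped Topology ENNReal symmDiff

namespace Summit.CriticalPhenomena.PercolationContinuityZ3.Theorems.FK

open Literature.Probability.Percolation Literature.Probability.LatticeModels

variable {d : ℕ}

/-! ### Deterministic: a connection off `Λ_m` exits `Λ_m` -/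

section Exit

/-- **Exit lemma on the infinite lattice** (the combinatorial step of Grimmett's Lemma (4.39)): for a LATTICE
configuration `ζ ⊆ 𝔼^d`, if `z ∈ Λ_m` is joined to `w` by a `ζ`-open path but not inside `Λ_m`, then `z` is
joined inside `Λ_{m+1}` to a site of `Λ_{m+1} ∖ Λ_m`. [cite: Grimmett2006, Lemma (4.39) and its proof, p. 83] -/
theorem exists_exit_of_reachable_of_not_mem_openConnVia {m : ℕ} {ζ : BondConfig (Site d)}
    (hζ : ζ ⊆ (zdGraph d).edgeSet) {z w : Site d} (hz : z ∈ box d m) (hreach : (openGraph ζ).Reachable z w)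
    (hnot : ζ ∉ openConnVia (withinGraph ⊤ (↑(box d m) : Set (Site d))) z w) :
    ∃ b ∈ box d (m + 1), b ∉ box d m ∧ ζ ∈ openConnVia (withinGraph ⊤ (↑(box d (m + 1)) : Set (Site d))) z b := by
  classical
  obtain ⟨pth⟩ := hreach
  set S : Set (Site d) := {c | ζ ∈ openConnVia (withinGraph ⊤ (↑(box d m) : Set (Site d))) z c} with hS
  have hzS : z ∈ S := self_mem_openClusterIn _ ζ z
  obtain ⟨dt, -, haS, hbS⟩ := pth.exists_boundary_dart S hzS hnot
  set a := dt.toProd.1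
  set b := dt.toProd.2
  have haz : a ∈ openClusterIn (withinGraph ⊤ (↑(box d m) : Set (Site d))) ζ z := haS
  have ham : a ∈ box d m :=
    Finset.mem_coe.1 (openClusterIn_withinGraph_subset (G := (⊤ : SimpleGraph (Site d))) (Finset.mem_coe.2 hz) ζ haz)
  have hopen := dt.adj
  rw [openGraph_adj] at hopen
  obtain ⟨hab, hne⟩ := hopen
  have hadj : (zdGraph d).Adj a b := by
    have := hζ hab
    rwa [SimpleGraph.mem_edgeSet] at this
  have hbm : b ∉ box d m := by
    intro hbm
    refine hbS (mem_openClusterIn_of_adj haz ?_ hab)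
    exact ⟨(SimpleGraph.top_adj _ _).2 hne, Finset.mem_coe.2 ham, Finset.mem_coe.2 hbm⟩
  refine ⟨b, mem_box_succ_of_zdGraph_adj d ham hadj, hbm, ?_⟩
  have haz' : a ∈ openClusterIn (withinGraph ⊤ (↑(box d (m + 1)) : Set (Site d))) ζ z :=
    openClusterIn_mono_graph (withinGraph_mono ⊤ (Finset.coe_subset.2 (box_mono d (Nat.le_succ m)))) ζ _ haz
  refine mem_openClusterIn_of_adj haz' ?_ hab
  exact ⟨(SimpleGraph.top_adj _ _).2 hne, Finset.mem_coe.2 (box_mono d (Nat.le_succ m) ham),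
    Finset.mem_coe.2 (mem_box_succ_of_zdGraph_adj d ham hadj)⟩

/-- **`K_e ∖ {x ↔ y inside Λ_m} ⊆ D_m`** for lattice configurations: if `x, y ∈ Λ_m` are joined in `ζ ⊆ 𝔼^d`
but not inside `Λ_m`, then both exit `Λ_m` (inside `Λ_{m+1}`) and they are not joined inside `Λ_m`.
[cite: Grimmett2006, Lemma (4.39) eqs. (4.40)–(4.42)] -/
theorem mem_exit_inter_of_mem_openConn_diff {m : ℕ} {ζ : BondConfig (Site d)} (hζ : ζ ⊆ (zdGraph d).edgeSet)
    {x y : Site d} (hx : x ∈ box d m) (hy : y ∈ box d m) (hK : ζ ∈ openConn x y)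
    (hKm : ζ ∉ openConnVia (withinGraph ⊤ (↑(box d m) : Set (Site d))) x y) :
    ζ ∈ {ω : BondConfig (Site d) | ∃ c ∈ box d (m + 1), c ∉ box d m ∧
          ω ∈ openConnVia (withinGraph ⊤ (↑(box d (m + 1)) : Set (Site d))) x c} ∩
        {ω | ∃ c ∈ box d (m + 1), c ∉ box d m ∧
          ω ∈ openConnVia (withinGraph ⊤ (↑(box d (m + 1)) : Set (Site d))) y c} ∩
        (openConnVia (withinGraph ⊤ (↑(box d m) : Set (Site d))) x y)ᶜ := by
  have hR : (openGraph ζ).Reachable x y := hK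
  have hKm' : ζ ∉ openConnVia (withinGraph ⊤ (↑(box d m) : Set (Site d))) y x := by
    intro h
    refine hKm ?_
    change y ∈ openClusterIn _ ζ x
    change x ∈ openClusterIn _ ζ y at h
    rw [mem_openClusterIn_iff] at h ⊢
    exact h.symm
  exact ⟨⟨exists_exit_of_reachable_of_not_mem_openConnVia hζ hx hR hKm,
    exists_exit_of_reachable_of_not_mem_openConnVia hζ hy hR.symm hKm'⟩, hKm⟩

end Exit

/-! ### Finite energy of a local limit, and the null event "`ω ∖ e` has two infinite clusters" -/

section Energy

variable {p q : ℝ} {P : Measure (BondConfig (Site d))} {μ : ℕ → Measure (BondConfig (Site d))} {x y : Site d}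

/-- Local convergence, read on real numbers. [folklore] -/
theorem tendsto_measureReal_of_tendsto_measure_isLocalEvent [IsFiniteMeasure P]
    (hconv : ∀ A : Set (BondConfig (Site d)), IsLocalEvent A → Tendsto (fun n => μ n A) atTop (𝓝 (P A)))
    {A : Set (BondConfig (Site d))} (hA : IsLocalEvent A) :
    Tendsto (fun n => (μ n).real A) atTop (𝓝 (P.real A)) := by
  show Tendsto (fun n => ((μ n) A).toReal) atTop (𝓝 ((P A).toReal))
  exact (ENNReal.tendsto_toReal (measure_ne_top P A)).comp (hconv A hA)

/-- Splitting `{ω ∖ e ∈ H₀}` along `K_e = {x ↔ y}`. [folklore] -/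
theorem measureReal_preimage_sdiff_eq_add (ν : Measure (BondConfig (Site d))) [IsFiniteMeasure ν]
    {H₀ : Set (BondConfig (Site d))} (hH₀ : MeasurableSet H₀) :
    ν.real ((fun η => η \ {s(x, y)}) ⁻¹' H₀) =
      ν.real ((fun η => η \ {s(x, y)}) ⁻¹' (H₀ ∩ openConn x y)) +
        ν.real ((fun η => η \ {s(x, y)}) ⁻¹' (H₀ ∩ (openConn x y)ᶜ)) := by
  have hfm : Measurable (fun η : BondConfig (Site d) => η \ {s(x, y)}) := measurable_closeEdges _
  have hKm : MeasurableSet (openConn x y : Set (BondConfig (Site d))) := measurableSet_openConn_holds x y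
  have hdisj : Disjoint ((fun η : BondConfig (Site d) => η \ {s(x, y)}) ⁻¹' (H₀ ∩ openConn x y))
      ((fun η => η \ {s(x, y)}) ⁻¹' (H₀ ∩ (openConn x y)ᶜ)) :=
    Set.disjoint_left.2 fun ω h1 h2 => h2.2 h1.2
  rw [← measureReal_union hdisj ((hH₀.inter hKm.compl).preimage hfm)]
  congr 1
  ext ω
  simp only [Set.mem_preimage, Set.mem_union, Set.mem_inter_iff, Set.mem_compl_iff]
  tauto

/-- **One-edge identity ⇒ one-sided finite energy**: a finite measure with the one-edge conditional
probabilities (4.38) at `e = ⟨x,y⟩` opens `e`, given the rest, with probability at most `max(p, p/(p+q(1-p)))`.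
[cite: Grimmett2006, Thm. (4.17)(b), eq. (4.32), Prop. (4.37) eq. (4.38)] -/
theorem measureReal_setOf_mem_inter_preimage_le_of_oneEdge (ν : Measure (BondConfig (Site d))) [IsFiniteMeasure ν]
    (hE : ∀ ⦃H₀ : Set (BondConfig (Site d))⦄, MeasurableSet H₀ →
      ν.real ({ω | s(x, y) ∈ ω} ∩ (fun η => η \ {s(x, y)}) ⁻¹' H₀) =
        p * ν.real ((fun η => η \ {s(x, y)}) ⁻¹' (H₀ ∩ openConn x y)) +
          p / (p + q * (1 - p)) * ν.real ((fun η => η \ {s(x, y)}) ⁻¹' (H₀ ∩ (openConn x y)ᶜ)))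
    {H₀ : Set (BondConfig (Site d))} (hH₀ : MeasurableSet H₀) :
    ν.real ({ω | s(x, y) ∈ ω} ∩ (fun η => η \ {s(x, y)}) ⁻¹' H₀) ≤
      max p (p / (p + q * (1 - p))) * ν.real ((fun η => η \ {s(x, y)}) ⁻¹' H₀) := by
  rw [hE hH₀, measureReal_preimage_sdiff_eq_add ν hH₀, mul_add]
  exact add_le_add (mul_le_mul_of_nonneg_right (le_max_left _ _) measureReal_nonneg)
    (mul_le_mul_of_nonneg_right (le_max_right _ _) measureReal_nonneg)

/-- **Finite energy of the local limit, on local events** (Grimmett 2006, Thm. (4.33)(b)): if the approximants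
eventually have the one-edge conditional probabilities at `e`, the local limit `P` opens `e`, given any LOCAL
outside information, with probability at most `max(p, p/(p+q(1-p)))`. [cite: Grimmett2006, Thm. (4.33)(b), proof of Thm. (4.31) p. 86] -/
theorem measureReal_setOf_mem_inter_preimage_le_of_localLimit_of_isLocalEvent [IsFiniteMeasure P]
    [∀ n, IsFiniteMeasure (μ n)]
    (hconv : ∀ A : Set (BondConfig (Site d)), IsLocalEvent A → Tendsto (fun n => μ n A) atTop (𝓝 (P A)))
    (hE : ∀ᶠ n in atTop, ∀ ⦃H₀ : Set (BondConfig (Site d))⦄, MeasurableSet H₀ →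
      (μ n).real ({ω | s(x, y) ∈ ω} ∩ (fun η => η \ {s(x, y)}) ⁻¹' H₀) =
        p * (μ n).real ((fun η => η \ {s(x, y)}) ⁻¹' (H₀ ∩ openConn x y)) +
          p / (p + q * (1 - p)) * (μ n).real ((fun η => η \ {s(x, y)}) ⁻¹' (H₀ ∩ (openConn x y)ᶜ)))
    {H₀ : Set (BondConfig (Site d))} (hH₀ : IsLocalEvent H₀) :
    P.real ({ω | s(x, y) ∈ ω} ∩ (fun η => η \ {s(x, y)}) ⁻¹' H₀) ≤
      max p (p / (p + q * (1 - p))) * P.real ((fun η => η \ {s(x, y)}) ⁻¹' H₀) := by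
  have hloc1 : IsLocalEvent ({ω : BondConfig (Site d) | s(x, y) ∈ ω} ∩ (fun η => η \ {s(x, y)}) ⁻¹' H₀) :=
    isLocalEvent_inter_preimage _ (isLocalEvent_setOf_mem _) hH₀
  have hloc2 : IsLocalEvent ((fun η : BondConfig (Site d) => η \ {s(x, y)}) ⁻¹' H₀) :=
    isLocalEvent_preimage_sdiff hH₀ _
  refine le_of_tendsto_of_tendsto (tendsto_measureReal_of_tendsto_measure_isLocalEvent hconv hloc1)
    ((tendsto_measureReal_of_tendsto_measure_isLocalEvent hconv hloc2).const_mul _) ?_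
  filter_upwards [hE] with n hn
  exact measureReal_setOf_mem_inter_preimage_le_of_oneEdge (μ n) hn (measurableSet_of_isLocalEvent_holds hH₀)

/-- **From local to measurable outside information** (approximation of measurable events by local events in
`P ∘ (· ∖ e)⁻¹`-measure). [cite: Grimmett2006, Thm. (4.33)(b)] -/
theorem measureReal_setOf_mem_inter_preimage_le_of_forall_isLocalEvent [IsFiniteMeasure P] {c : ℝ} (hc : 0 ≤ c)
    (h : ∀ ⦃A : Set (BondConfig (Site d))⦄, IsLocalEvent A →
      P.real ({ω | s(x, y) ∈ ω} ∩ (fun η => η \ {s(x, y)}) ⁻¹' A) ≤ c * P.real ((fun η => η \ {s(x, y)}) ⁻¹' A))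
    {H₀ : Set (BondConfig (Site d))} (hH₀ : MeasurableSet H₀) :
    P.real ({ω | s(x, y) ∈ ω} ∩ (fun η => η \ {s(x, y)}) ⁻¹' H₀) ≤
      c * P.real ((fun η => η \ {s(x, y)}) ⁻¹' H₀) := by
  set f : BondConfig (Site d) → BondConfig (Site d) := fun η => η \ {s(x, y)} with hf
  have hfm : Measurable f := measurable_closeEdges _
  haveI : IsFiniteMeasure (P.map f) := Measure.isFiniteMeasure_map P f
  refine le_of_forall_pos_le_add fun ε hε => ?_
  have hε' : 0 < ε / (1 + c) := div_pos hε (by linarith)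
  obtain ⟨B, hB, hBH⟩ := exists_isLocalEvent_measure_symmDiff_lt (μ := P.map f) hH₀
    (ENNReal.ofReal_pos.2 hε')
  have hBm : MeasurableSet B := measurableSet_of_isLocalEvent_holds hB
  have hδ : P.real (f ⁻¹' (B ∆ H₀)) < ε / (1 + c) := by
    have h1 : (P.map f) (B ∆ H₀) = P (f ⁻¹' (B ∆ H₀)) := Measure.map_apply hfm (hBm.symmDiff hH₀)
    rw [measureReal_def, ← h1]
    exact (ENNReal.lt_ofReal_iff_toReal_lt (measure_ne_top _ _)).1 hBH
  -- the three comparisons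
  have h1 : P.real ({ω | s(x, y) ∈ ω} ∩ f ⁻¹' H₀) ≤ P.real ({ω | s(x, y) ∈ ω} ∩ f ⁻¹' B) + P.real (f ⁻¹' (B ∆ H₀)) := by
    calc P.real ({ω | s(x, y) ∈ ω} ∩ f ⁻¹' H₀)
        ≤ P.real (({ω | s(x, y) ∈ ω} ∩ f ⁻¹' B) ∪ f ⁻¹' (B ∆ H₀)) :=
          measureReal_mono (fun ω hω => by
            by_cases hB' : f ω ∈ B
            · exact Or.inl ⟨hω.1, hB'⟩
            · exact Or.inr (Set.mem_symmDiff.2 (Or.inr ⟨hω.2, hB'⟩))) (measure_ne_top _ _)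
      _ ≤ _ := measureReal_union_le _ _
  have h2 : P.real (f ⁻¹' B) ≤ P.real (f ⁻¹' H₀) + P.real (f ⁻¹' (B ∆ H₀)) := by
    calc P.real (f ⁻¹' B) ≤ P.real (f ⁻¹' H₀ ∪ f ⁻¹' (B ∆ H₀)) :=
          measureReal_mono (fun ω hω => by
            by_cases hH' : f ω ∈ H₀
            · exact Or.inl hH'
            · exact Or.inr (Set.mem_symmDiff.2 (Or.inl ⟨hω, hH'⟩))) (measure_ne_top _ _)
      _ ≤ _ := measureReal_union_le _ _
  have h3 := h hB
  have hkey : P.real ({ω | s(x, y) ∈ ω} ∩ f ⁻¹' H₀) ≤ c * P.real (f ⁻¹' H₀) + (1 + c) * P.real (f ⁻¹' (B ∆ H₀)) := by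
    nlinarith [h1, h2, h3, hc, measureReal_nonneg (μ := P) (s := f ⁻¹' (B ∆ H₀))]
  have h4 : (1 + c) * P.real (f ⁻¹' (B ∆ H₀)) ≤ ε := by
    have := (lt_div_iff₀ (by linarith : (0 : ℝ) < 1 + c)).1 hδ
    linarith [mul_comm (1 + c) (P.real (f ⁻¹' (B ∆ H₀)))]
  linarith

/-- **The local limit has a.s. at most one infinite cluster off `e` too**: finite energy (`c < 1`) transfers
the a.s. uniqueness of the infinite cluster from `ω` to `ω ∖ e` (Grimmett's (4.42): closing `e` costs at most the
factor `1/(1-c)`). [cite: Grimmett2006, Lemma (4.39) eq. (4.42), proof of Thm. (4.31) p. 86] -/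
theorem measureReal_preimage_sdiff_not_numInfiniteClusters_le_one_eq_zero [IsFiniteMeasure P] {c : ℝ}
    (hc : c < 1)
    (h : ∀ ⦃H₀ : Set (BondConfig (Site d))⦄, MeasurableSet H₀ →
      P.real ({ω | s(x, y) ∈ ω} ∩ (fun η => η \ {s(x, y)}) ⁻¹' H₀) ≤ c * P.real ((fun η => η \ {s(x, y)}) ⁻¹' H₀))
    (huniq : ∀ᵐ ω ∂P, numInfiniteClusters ω ≤ 1) :
    P.real ((fun η : BondConfig (Site d) => η \ {s(x, y)}) ⁻¹' {ω | ¬ numInfiniteClusters ω ≤ 1}) = 0 := by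
  set f : BondConfig (Site d) → BondConfig (Site d) := fun η => η \ {s(x, y)} with hf
  set U : Set (BondConfig (Site d)) := {ω | ¬ numInfiniteClusters ω ≤ 1} with hU
  have hUm : MeasurableSet U := measurableSet_not_numInfiniteClusters_le_one (V := Site d)
  have h0 : P.real U = 0 := by
    rw [measureReal_def, show P U = 0 from ae_iff.1 huniq, ENNReal.toReal_zero]
  -- off `{e open}`, `ω ∖ e = ω`
  have hsub : f ⁻¹' U \ {ω | s(x, y) ∈ ω} ⊆ U := by
    rintro ω ⟨hωU, hωe⟩
    have hωω : f ω = ω := Set.sdiff_singleton_eq_self hωe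
    rwa [Set.mem_preimage, hωω] at hωU
  have h1 : P.real (f ⁻¹' U) ≤ P.real ({ω | s(x, y) ∈ ω} ∩ f ⁻¹' U) + P.real (f ⁻¹' U \ {ω | s(x, y) ∈ ω}) := by
    calc P.real (f ⁻¹' U) = P.real (({ω | s(x, y) ∈ ω} ∩ f ⁻¹' U) ∪ (f ⁻¹' U \ {ω | s(x, y) ∈ ω})) := by
          congr 1
          ext ω
          simp only [Set.mem_union, Set.mem_inter_iff, Set.mem_sdiff, Set.mem_setOf_eq, Set.mem_preimage]
          tauto
      _ ≤ _ := measureReal_union_le _ _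
  have h2 : P.real (f ⁻¹' U \ {ω | s(x, y) ∈ ω}) ≤ 0 :=
    (measureReal_mono hsub (measure_ne_top _ _)).trans h0.le
  have h3 := h hUm
  have h4 : (1 - c) * P.real (f ⁻¹' U) ≤ 0 := by nlinarith [h1, h2, h3]
  have h5 : P.real (f ⁻¹' U) ≤ 0 := le_of_mul_le_mul_left (by rwa [mul_zero]) (sub_pos.2 hc)
  exact le_antisymm h5 measureReal_nonneg

/-- **The bad events have vanishing probability** (Grimmett 2006, proof of Thm. (4.31), last display, p. 86):
if `P{ω ∖ e has ≥ 2 infinite clusters} = 0` then `P(D_m) → 0`, where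
`D_m = {off e : x and y both exit Λ_m inside Λ_{m+1}, and are not joined inside Λ_m}`
(`D_m ⊆ ⋃_{k ≥ m} D_k ↓ limsup D ⊆ {ω ∖ e has two infinite clusters}`). [cite: Grimmett2006, proof of Thm. (4.31) p. 86, Lemma (4.39) eqs. (4.40)–(4.42)] -/
theorem tendsto_measureReal_exit_inter_not_openConnVia (P : Measure (BondConfig (Site d))) [IsFiniteMeasure P]
    (x y : Site d)
    (h0 : P.real ((fun η : BondConfig (Site d) => η \ {s(x, y)}) ⁻¹' {ω | ¬ numInfiniteClusters ω ≤ 1}) = 0) :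
    Tendsto (fun m : ℕ => P.real
      ((fun η : BondConfig (Site d) => η \ {s(x, y)}) ⁻¹' {ω | ∃ c ∈ box d (m + 1), c ∉ box d m ∧
          ω ∈ openConnVia (withinGraph ⊤ (↑(box d (m + 1)) : Set (Site d))) x c} ∩
        (fun η : BondConfig (Site d) => η \ {s(x, y)}) ⁻¹' {ω | ∃ c ∈ box d (m + 1), c ∉ box d m ∧
          ω ∈ openConnVia (withinGraph ⊤ (↑(box d (m + 1)) : Set (Site d))) y c} ∩
        ((fun η : BondConfig (Site d) => η \ {s(x, y)}) ⁻¹'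
          openConnVia (withinGraph ⊤ (↑(box d m) : Set (Site d))) x y)ᶜ)) atTop (𝓝 0) := by
  classical
  set f : BondConfig (Site d) → BondConfig (Site d) := fun η => η \ {s(x, y)} with hf
  have hfm : Measurable f := measurable_closeEdges _
  set D : ℕ → Set (BondConfig (Site d)) := fun m =>
    f ⁻¹' {ω | ∃ c ∈ box d (m + 1), c ∉ box d m ∧
        ω ∈ openConnVia (withinGraph ⊤ (↑(box d (m + 1)) : Set (Site d))) x c} ∩
      f ⁻¹' {ω | ∃ c ∈ box d (m + 1), c ∉ box d m ∧
        ω ∈ openConnVia (withinGraph ⊤ (↑(box d (m + 1)) : Set (Site d))) y c} ∩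
      (f ⁻¹' openConnVia (withinGraph ⊤ (↑(box d m) : Set (Site d))) x y)ᶜ with hD
  have hDm : ∀ m, MeasurableSet (D m) := fun m =>
    (((measurableSet_of_isLocalEvent_holds (isLocalEvent_exit m x)).preimage hfm).inter
      ((measurableSet_of_isLocalEvent_holds (isLocalEvent_exit m y)).preimage hfm)).inter
      ((measurableSet_openConnVia _ x y).preimage hfm).compl
  set V : ℕ → Set (BondConfig (Site d)) := fun N => ⋃ m, ⋃ (_ : N ≤ m), D m with hV
  have hVanti : Antitone V := by
    intro N N' hNN' ω hω
    simp only [hV, Set.mem_iUnion, exists_prop] at hω ⊢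
    obtain ⟨m, hm, hωm⟩ := hω
    exact ⟨m, hNN'.trans hm, hωm⟩
  have hVm : ∀ N, MeasurableSet (V N) := fun N =>
    MeasurableSet.iUnion fun m => MeasurableSet.iUnion fun _ => hDm m
  have hV0 : P.real (⋂ N, V N) = 0 := by
    refine le_antisymm ?_ measureReal_nonneg
    calc P.real (⋂ N, V N) ≤ P.real (f ⁻¹' {ω | ¬ numInfiniteClusters ω ≤ 1}) :=
          measureReal_mono (mem_iInter_iUnion_exit_subset x y) (measure_ne_top _ _)
      _ = 0 := h0
  have hVlim : Tendsto (fun N => P.real (V N)) atTop (𝓝 0) := by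
    rw [← hV0]
    exact tendsto_measureReal_iInter_of_antitone P hVanti hVm
  refine squeeze_zero (fun m => measureReal_nonneg) (fun m => ?_) hVlim
  exact measureReal_mono (fun ω hω => Set.mem_iUnion.2 ⟨m, Set.mem_iUnion.2 ⟨le_rfl, hω⟩⟩)
    (measure_ne_top P _)

end Energy


/-! ### From local to measurable outside information, for the one-edge identity -/

section Extension

variable {p : ℝ} {P : Measure (BondConfig (Site d))} {x y : Site d}

/-- **From local to measurable outside information, for the identity**: two finite measures that agree on local
events agree (`ext_of_isLocalEvent`), applied to `A ↦ P({e open} ∩ {ω ∖ e ∈ A})` and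
`A ↦ p P({ω ∖ e ∈ A ∩ K_e}) + π P({ω ∖ e ∈ A ∖ K_e})`. [cite: Grimmett2006, proof of Thm. (4.31), "(4.46) holds for all A ∈ 𝓕", p. 85] -/
theorem measureReal_setOf_mem_inter_preimage_eq_of_forall_isLocalEvent [IsFiniteMeasure P] (hp0 : 0 ≤ p)
    {π : ℝ} (hπ0 : 0 ≤ π)
    (h : ∀ ⦃A : Set (BondConfig (Site d))⦄, IsLocalEvent A →
      P.real ({ω | s(x, y) ∈ ω} ∩ (fun η => η \ {s(x, y)}) ⁻¹' A) =
        p * P.real ((fun η => η \ {s(x, y)}) ⁻¹' (A ∩ openConn x y)) +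
          π * P.real ((fun η => η \ {s(x, y)}) ⁻¹' (A ∩ (openConn x y)ᶜ)))
    {H₀ : Set (BondConfig (Site d))} (hH₀ : MeasurableSet H₀) :
    P.real ({ω | s(x, y) ∈ ω} ∩ (fun η => η \ {s(x, y)}) ⁻¹' H₀) =
      p * P.real ((fun η => η \ {s(x, y)}) ⁻¹' (H₀ ∩ openConn x y)) +
        π * P.real ((fun η => η \ {s(x, y)}) ⁻¹' (H₀ ∩ (openConn x y)ᶜ)) := by
  set f : BondConfig (Site d) → BondConfig (Site d) := fun η => η \ {s(x, y)} with hf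
  set K : Set (BondConfig (Site d)) := openConn x y with hK
  set J : Set (BondConfig (Site d)) := {ω | s(x, y) ∈ ω} with hJ
  have hfm : Measurable f := measurable_closeEdges _
  have hKmeas : MeasurableSet K := measurableSet_openConn_holds x y
  have hJm : MeasurableSet J := measurableSet_mem _
  set ν₁ : Measure (BondConfig (Site d)) := (P.restrict J).map f with hν₁
  set ν₂ : Measure (BondConfig (Site d)) :=
    ENNReal.ofReal p • (P.map f).restrict K + ENNReal.ofReal π • (P.map f).restrict Kᶜ with hν₂
  haveI : IsFiniteMeasure ν₁ := Measure.isFiniteMeasure_map _ f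
  -- evaluation of the two measures on measurable sets
  have ev1 : ∀ {A : Set (BondConfig (Site d))}, MeasurableSet A → ν₁ A = P (J ∩ f ⁻¹' A) := by
    intro A hA
    rw [hν₁, Measure.map_apply hfm hA, Measure.restrict_apply (hA.preimage hfm), Set.inter_comm]
  have ev2 : ∀ {A : Set (BondConfig (Site d))}, MeasurableSet A →
      ν₂ A = ENNReal.ofReal p * P (f ⁻¹' (A ∩ K)) + ENNReal.ofReal π * P (f ⁻¹' (A ∩ Kᶜ)) := by
    intro A hA
    rw [hν₂, Measure.add_apply, Measure.smul_apply, Measure.smul_apply, smul_eq_mul, smul_eq_mul,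
      Measure.restrict_apply hA, Measure.restrict_apply hA, Measure.map_apply hfm (hA.inter hKmeas),
      Measure.map_apply hfm (hA.inter hKmeas.compl)]
  -- the real identity, in `ℝ≥0∞` form
  have key : ∀ {A : Set (BondConfig (Site d))}, MeasurableSet A →
      (P.real (J ∩ f ⁻¹' A) = p * P.real (f ⁻¹' (A ∩ K)) + π * P.real (f ⁻¹' (A ∩ Kᶜ)) ↔
        P (J ∩ f ⁻¹' A) = ENNReal.ofReal p * P (f ⁻¹' (A ∩ K)) + ENNReal.ofReal π * P (f ⁻¹' (A ∩ Kᶜ))) := by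
    intro A hA
    rw [← ofReal_measureReal (measure_ne_top P (J ∩ f ⁻¹' A)), ← ofReal_measureReal (measure_ne_top P (f ⁻¹' (A ∩ K))),
      ← ofReal_measureReal (measure_ne_top P (f ⁻¹' (A ∩ Kᶜ))), ← ENNReal.ofReal_mul hp0, ← ENNReal.ofReal_mul hπ0,
      ← ENNReal.ofReal_add (mul_nonneg hp0 measureReal_nonneg) (mul_nonneg hπ0 measureReal_nonneg),
      ENNReal.ofReal_eq_ofReal_iff measureReal_nonneg
        (add_nonneg (mul_nonneg hp0 measureReal_nonneg) (mul_nonneg hπ0 measureReal_nonneg))]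
  have hν : ν₁ = ν₂ := ext_of_isLocalEvent fun A hA => by
    have hAm : MeasurableSet A := measurableSet_of_isLocalEvent_holds hA
    rw [ev1 hAm, ev2 hAm]
    exact (key hAm).1 (h hA)
  have hH : ν₁ H₀ = ν₂ H₀ := by rw [hν]
  rw [ev1 hH₀, ev2 hH₀] at hH
  exact (key hH₀).2 hH

end Extension

end Summit.CriticalPhenomena.PercolationContinuityZ3.Theorems.FK

end
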